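import Mathlib
import HarnessLib
import Summits.HubbardSuperconductivity.HubbardSuperconductivity.Theorems.KLProgrammeKLRegimeTwoVolumeTowerTransferWtData

/-!
# K3 VL child `KLRegimeVolumeLimitV17F2` (stmt-HubbardSuperconductivity-20440), located item #23 «W2-HALF-VL», part 1: THE TELESCOPE BASES — p3's three
# M3b-j doors in the tower's vocabulary at ANY EARLIER FLOW FRAME `K_m`, `1 ≤ m ≤ n`, from the CURRENT history alone

Cell `gate-hubbard-kl`, seat p3 (g13).  The W5 spine (`…TwoVolumeTowerSpine`, k3c4-p1 g13) reads its one-volume data at the TOP frame `K_{n⋆}`; p3's doors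
`scaleCovData_/scaleCovSecData_klStepCov_klEng_flow_deep_vol (d)`, `rowColSumWt_klReanalysis_klEng_flow_deep_vol (d)` and
`transferWtData_klTowerTransfer_klEng_flow_deep_vol (d)` serve a step `k` there only inside the deep window `4^{n⋆+2}·U ≤ 4^{2k+d}` (located item #23,
memo HOME/p3/g13/W2-HALF-VL.md).  The cure is a frame telescope `K_{m₀(k)} → K_{n⋆}` whose BASE is the same door at the deepest frame `K_{m₀}` inside the
window.  This file states the four bases BY NAME: each `_vol` door at the flow frame `K_m = klFlowFrameU L M β U μ m` for every `1 ≤ m ≤ n`, with its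
two frame inputs (`HistP … 0 m`, `FrameOK … K_m`) discharged from the current history `HistP … 0 n` (p3 g11 `histP_klPredsV17F2_restrict`,
`frameOK_klFlowFrameU_of_histP_le`) — no separate `FrameOK` binder, window `4^{m+2}·U ≤ 4^{2k+d}` (resp. `4^m·U ≤ 4^{2(k+1)+d}`, `4^m·U ≤ 4^{2j+d}`) AT `m`:

* `scaleCovData_klStepCov_klEng_flow_deep_vol_at (d)` — `ScaleCovData (klStepCov V M β μ K_m k) Λ_w κ_k (Cα·(M/β)/Λ_{k+2}) Ce`;
* `scaleCovSecData_klStepCov_klEng_flow_deep_vol_at (d)` — `ScaleCovSecData (klStepCov V M β μ K_m k) Λ_w Ce`;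
* `rowColSumWt_klReanalysis_klEng_flow_deep_vol_at (d)` — `klScaleWt (k+1)`-weighted rows and columns of `klReanalysis V M β μ K_m k` `≤ Cr`;
* `transferWtData_klTowerTransfer_klEng_flow_deep_vol_at (d)` — `TransferWtData (klTowerTransfer (b·L) M β μ K_m j) (klBlockEquivD L b M j)
  (klBlockEquivD L b M (j−1)) Λ_T Cw`.

Same constants as the top-frame doors.  Everything is proved; no definitions; nothing asserts any stub, K3, VL or superconductivity.
[cite: BenfattoGiulianiMastropietro2006, §2.7 (2.70)–(2.71a), §2.8 (2.81), §3 (3.2)–(3.3)]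
-/

noncomputable section

namespace Summit.HubbardSuperconductivity.HubbardSuperconductivity.Theorems.TorusFourierL2

set_option linter.dupNamespace false -- summit = problem name (single-conjunct summit), D-0017

open Set Finset Literature.MathematicalPhysics.QuantumLattice Literature.MathematicalPhysics.QuantumLattice.BandSectorCounting
open Literature.MathematicalPhysics.QuantumLattice.FermiRG Literature.Probability.LatticeModels Literature.Analysis.SpecialFunctions
open Summit.HubbardSuperconductivity.HubbardSuperconductivity.Theorems.DispersionFlow
open Summit.HubbardSuperconductivity.HubbardSuperconductivity.Theorems.KLRegimeSplit
open Summit.HubbardSuperconductivity.HubbardSuperconductivity.Theorems.KLProgrammeLegKernels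
open Summit.HubbardSuperconductivity.HubbardSuperconductivity.Theorems.PerturbedFermiCurve
open Summit.HubbardSuperconductivity.HubbardSuperconductivity.Theorems.KLRegimeWick
open Summit.HubbardSuperconductivity.HubbardSuperconductivity.Theorems.EngineV8
open Summit.HubbardSuperconductivity.HubbardSuperconductivity.Theorems.TwoVolumeSource
open Summit.HubbardSuperconductivity.HubbardSuperconductivity.Theorems.TwoVolumeDefect
open scoped Real Nat

open Classical

set_option maxHeartbeats 800000 in -- long binder list
/-- **Telescope base, covariance bundle**: `ScaleCovData (klStepCov V M β μ K_m k) Λ_w κ_k (Cα·(M/β)/Λ_{k+2}) Ce` at every earlier flow frame `K_m`,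
`1 ≤ m ≤ n`, from the current history `HistP … 0 n` (window `4^{m+2}·U ≤ 4^{2k+d}` at `m`; same constants as
`scaleCovData_klStepCov_klEng_flow_deep_vol`). [cite: BenfattoGiulianiMastropietro2006, §2.8 (2.81), §3 (3.3)] -/
theorem scaleCovData_klStepCov_klEng_flow_deep_vol_at (dd : ℕ) :
    ∃ Cκ Cα Ce : ℝ, 0 < Cκ ∧ 0 < Cα ∧ 0 < Ce ∧
      ∀ (G : GeoConsts) (P : SplitConsts) (R : RenConsts) (Q : EngConsts) (cc : ℝ), P.WF → R.WF2 → 0 < cc → cc ≤ EngineV8.klEngC₃6 P R →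
      ∀ μ ∈ klWindowC, ∀ U : ℝ, 0 < U → U ≤ min (EngineV8.klEngU₀3 P R cc) (1 / (R.Gfr 3 + 1)) → U ≤ EngineV8.klEngU₀4 P R cc →
      ∀ β : ℝ, klBetaMin ≤ β → β ≤ Real.exp (cc / U ^ 2) →
      ∀ (L M : ℕ) [NeZero L] [NeZero M], EngineV8.klEngL₃ β U ≤ L → EngineV8.klEngM₃ β U L ≤ M →
      ∀ n : ℕ, n ≤ nScales β + 1 → HistP klPredsV17F2 L M G P Q R β U μ 0 n →
        ∀ m : ℕ, 1 ≤ m → m ≤ n →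
        ∀ (V : ℕ) [NeZero V], EngineV8.klEngL₃ β U ≤ V → EngineV8.klEngM₃ β U V ≤ M →
        ∀ k : ℕ, 1 ≤ k → k + 2 ≤ nScales β + 1 → (4 : ℝ) ^ (m + 2) * U ≤ (4 : ℝ) ^ (2 * k + dd) →
        ∀ Λw : ℝ, 0 ≤ Λw → Λw ≤ klScale klE0 (k + 2) →
          TwoVolumeDefect.ScaleCovData (klStepCov V M β μ (klFlowFrameU L M β U μ m) k) Λw
            (Real.sqrt (Cκ * (klScale klE0 k / klScale klE0 (k + 2)) * (klE0 * ((8 : ℝ) ^ k)⁻¹)))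
            (Cα * ((M : ℝ) / β) / klScale klE0 (k + 2)) Ce := by
  obtain ⟨Cκ, Cα, Ce, hCκ, hCα, hCe, h⟩ := scaleCovData_klStepCov_klEng_flow_deep_vol dd
  refine ⟨Cκ, Cα, Ce, hCκ, hCα, hCe, ?_⟩
  intro G P R Q cc hP hR2 hcc hcc6 μ hμ U hU hUle hU4 β hβmin hβc L M _ _ hL3 hM3 n hnN hhist m hm1 hmn V _ hV3 hVM3 k hk hkN hwin Λw hΛw0 hΛwle
  exact h G P R Q cc hP hR2 hcc hcc6 μ hμ U hU hUle hU4 β hβmin hβc L M hL3 hM3 m hm1 (hmn.trans hnN) (histP_klPredsV17F2_restrict hmn hhist)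
    (frameOK_klFlowFrameU_of_histP_le hR2 hm1 hmn (hmn.trans hnN) hhist) V hV3 hVM3 k hk hkN hwin Λw hΛw0 hΛwle

set_option maxHeartbeats 800000 in -- long binder list
/-- **Telescope base, sectional row**: `ScaleCovSecData (klStepCov V M β μ K_m k) Λ_w Ce` at every earlier flow frame `K_m`, `1 ≤ m ≤ n`, from the
current history (window `4^{m+2}·U ≤ 4^{2k+d}` at `m`; same constant as `scaleCovSecData_klStepCov_klEng_flow_deep_vol`).
[cite: BenfattoGiulianiMastropietro2006, §2.8 (2.81), §3 (3.3)] -/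
theorem scaleCovSecData_klStepCov_klEng_flow_deep_vol_at (dd : ℕ) :
    ∃ Ce : ℝ, 0 < Ce ∧
      ∀ (G : GeoConsts) (P : SplitConsts) (R : RenConsts) (Q : EngConsts) (cc : ℝ), R.WF2 → 0 < cc → cc ≤ EngineV8.klEngC₃6 P R →
      ∀ μ ∈ klWindowC, ∀ U : ℝ, 0 < U → U ≤ min (EngineV8.klEngU₀3 P R cc) (1 / (R.Gfr 3 + 1)) →
      ∀ β : ℝ, klBetaMin ≤ β → β ≤ Real.exp (cc / U ^ 2) →
      ∀ (L M : ℕ) [NeZero L] [NeZero M], EngineV8.klEngL₃ β U ≤ L → EngineV8.klEngM₃ β U L ≤ M →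
      ∀ n : ℕ, n ≤ nScales β + 1 → HistP klPredsV17F2 L M G P Q R β U μ 0 n →
        ∀ m : ℕ, 1 ≤ m → m ≤ n →
        ∀ (V : ℕ) [NeZero V], EngineV8.klEngL₃ β U ≤ V →
        ∀ k : ℕ, 1 ≤ k → k + 2 ≤ nScales β + 1 → (4 : ℝ) ^ (m + 2) * U ≤ (4 : ℝ) ^ (2 * k + dd) →
        ∀ Λw : ℝ, 0 ≤ Λw → Λw ≤ klScale klE0 (k + 2) →
          TwoVolumeDefect.ScaleCovSecData (klStepCov V M β μ (klFlowFrameU L M β U μ m) k) Λw Ce := by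
  obtain ⟨Ce, hCe, h⟩ := scaleCovSecData_klStepCov_klEng_flow_deep_vol dd
  refine ⟨Ce, hCe, ?_⟩
  intro G P R Q cc hR2 hcc hcc6 μ hμ U hU hUle β hβmin hβc L M _ _ hL3 hM3 n hnN hhist m hm1 hmn V _ hV3 k hk hkN hwin Λw hΛw0 hΛwle
  exact h G P R Q cc hR2 hcc hcc6 μ hμ U hU hUle β hβmin hβc L M hL3 hM3 m hm1 (hmn.trans hnN) (histP_klPredsV17F2_restrict hmn hhist)
    (frameOK_klFlowFrameU_of_histP_le hR2 hm1 hmn (hmn.trans hnN) hhist) V hV3 k hk hkN hwin Λw hΛw0 hΛwle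

set_option maxHeartbeats 800000 in -- long binder list
/-- **Telescope base, re-analysis rows and columns**: the `klScaleWt V M β (k+1)`-weighted row and column sums of `klReanalysis V M β μ K_m k` are
`≤ Cr` at every earlier flow frame `K_m`, `1 ≤ m ≤ n`, from the current history (`k + 1 ≤ m`, window `4^m·U ≤ 4^{2(k+1)+d}` at `m`; same constant as
`rowColSumWt_klReanalysis_klEng_flow_deep_vol`). [cite: BenfattoGiulianiMastropietro2006, §2.7 (2.71a), §2.8 (2.77), (2.82)–(2.83)] -/
theorem rowColSumWt_klReanalysis_klEng_flow_deep_vol_at (dd : ℕ) :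
    ∃ Cr : ℝ, 0 < Cr ∧
      ∀ (G : GeoConsts) (P : SplitConsts) (R : RenConsts) (Q : EngConsts) (cc : ℝ), R.WF2 → 0 < cc → cc ≤ EngineV8.klEngC₃6 P R →
      ∀ μ ∈ klWindowC, ∀ U : ℝ, 0 < U → U ≤ min (EngineV8.klEngU₀3 P R cc) (1 / (R.Gfr 3 + 1)) →
      ∀ β : ℝ, klBetaMin ≤ β → β ≤ Real.exp (cc / U ^ 2) →
      ∀ (L M : ℕ) [NeZero L] [NeZero M], EngineV8.klEngL₃ β U ≤ L → EngineV8.klEngM₃ β U L ≤ M →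
      ∀ n : ℕ, n ≤ nScales β + 1 → HistP klPredsV17F2 L M G P Q R β U μ 0 n →
        ∀ m : ℕ, 1 ≤ m → m ≤ n →
        ∀ (V : ℕ) [NeZero V], EngineV8.klEngL₃ β U ≤ V →
        ∀ k : ℕ, k + 1 ≤ m → (4 : ℝ) ^ m * U ≤ (4 : ℝ) ^ (2 * (k + 1) + dd) →
        (∀ X'' : SpaceTimeIdx V M × SectorLeg (sectorCount (k + 1)),
          ∑ X' : SpaceTimeIdx V M × SectorLeg (sectorCount k), ‖klReanalysis V M β μ (klFlowFrameU L M β U μ m) k X'' X'‖ *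
            EngineV8.klScaleWt V M β (k + 1) {EngineV8.latticeLegPos (2 * (2 * M)) X'', EngineV8.latticeLegPos (2 * (2 * M)) X'} ≤ Cr) ∧
        (∀ X' : SpaceTimeIdx V M × SectorLeg (sectorCount k),
          ∑ X'' : SpaceTimeIdx V M × SectorLeg (sectorCount (k + 1)), ‖klReanalysis V M β μ (klFlowFrameU L M β U μ m) k X'' X'‖ *
            EngineV8.klScaleWt V M β (k + 1) {EngineV8.latticeLegPos (2 * (2 * M)) X'', EngineV8.latticeLegPos (2 * (2 * M)) X'} ≤ Cr) := by
  obtain ⟨Cr, hCr, h⟩ := rowColSumWt_klReanalysis_klEng_flow_deep_vol dd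
  refine ⟨Cr, hCr, ?_⟩
  intro G P R Q cc hR2 hcc hcc6 μ hμ U hU hUle β hβmin hβc L M _ _ hL3 hM3 n hnN hhist m hm1 hmn V _ hV3 k hkm hwin
  exact h G P R Q cc hR2 hcc hcc6 μ hμ U hU hUle β hβmin hβc L M hL3 hM3 m hm1 (hmn.trans hnN) (histP_klPredsV17F2_restrict hmn hhist)
    (frameOK_klFlowFrameU_of_histP_le hR2 hm1 hmn (hmn.trans hnN) hhist) V hV3 k hkm hwin

set_option maxHeartbeats 800000 in -- long binder list
/-- **Telescope base, transfer bundle**: `TransferWtData (klTowerTransfer (b·L) M β μ K_m j) (klBlockEquivD L b M j) (klBlockEquivD L b M (j−1)) Λ_T Cw`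
at every earlier flow frame `K_m`, `1 ≤ m ≤ n`, from the current history (`j ≤ m`, window `4^m·U ≤ 4^{2j+d}` at `m` when `1 ≤ j`; same constant as
`transferWtData_klTowerTransfer_klEng_flow_deep_vol`). [cite: BenfattoGiulianiMastropietro2006, §2.7 (2.70)–(2.71a), §3 (3.2)–(3.8)] -/
theorem transferWtData_klTowerTransfer_klEng_flow_deep_vol_at (dd : ℕ) :
    ∃ Cw : ℝ, 1 ≤ Cw ∧
      ∀ (G : GeoConsts) (P : SplitConsts) (R : RenConsts) (Q : EngConsts) (cc : ℝ), R.WF2 → 0 < cc → cc ≤ EngineV8.klEngC₃6 P R →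
      ∀ μ ∈ klWindowC, ∀ U : ℝ, 0 < U → U ≤ min (EngineV8.klEngU₀3 P R cc) (1 / (R.Gfr 3 + 1)) →
      ∀ β : ℝ, klBetaMin ≤ β → β ≤ Real.exp (cc / U ^ 2) →
      ∀ (L M : ℕ) [NeZero L] [NeZero M], EngineV8.klEngL₃ β U ≤ L → EngineV8.klEngM₃ β U L ≤ M →
      ∀ n : ℕ, n ≤ nScales β + 1 → HistP klPredsV17F2 L M G P Q R β U μ 0 n →
        ∀ m : ℕ, 1 ≤ m → m ≤ n →
        ∀ (b : ℕ) [NeZero (b * L)], EngineV8.klEngL₃ β U ≤ b * L →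
        ∀ j : ℕ, j ≤ m → (1 ≤ j → (4 : ℝ) ^ m * U ≤ (4 : ℝ) ^ (2 * j + dd)) →
        ∀ ΛT : ℝ, 0 ≤ ΛT → ΛT ≤ klScale klE0 j →
          TransferWtData (klTowerTransfer (b * L) M β μ (klFlowFrameU L M β U μ m) j)
            (klBlockEquivD L b M j) (klBlockEquivD L b M (j - 1)) ΛT Cw := by
  obtain ⟨Cw, hCw, h⟩ := transferWtData_klTowerTransfer_klEng_flow_deep_vol dd
  refine ⟨Cw, hCw, ?_⟩
  intro G P R Q cc hR2 hcc hcc6 μ hμ U hU hUle β hβmin hβc L M _ _ hL3 hM3 n hnN hhist m hm1 hmn b _ hV3 j hjm hwin ΛT hΛT0 hΛTle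
  exact h G P R Q cc hR2 hcc hcc6 μ hμ U hU hUle β hβmin hβc L M hL3 hM3 m hm1 (hmn.trans hnN) (histP_klPredsV17F2_restrict hmn hhist)
    (frameOK_klFlowFrameU_of_histP_le hR2 hm1 hmn (hmn.trans hnN) hhist) b hV3 j hjm hwin ΛT hΛT0 hΛTle

end Summit.HubbardSuperconductivity.HubbardSuperconductivity.Theorems.TorusFourierL2

end
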